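import Literature.NumberTheory.GaloisRepresentations.CyclotomicCharacterArtinNormProofs
import Literature.NumberTheory.GaloisRepresentations.LubinTateMultiplicativeGroup
import HarnessLib

/-!
# The Lubin–Tate base `(𝒪_F, p, p)` of the multiplicative group over an unramified base of residue
# degree one (`F ≅ ℚ_p`): `IsLTRing (p : 𝒪[F]) p`, and the instance `F = ℚ_p`

Topic `NumberTheory/GaloisRepresentations`; namespace `Literature.NumberTheory.GaloisRepresentations`.
Cell `bsd-print-cf2` (HOME `run/shared/lean/pub/bsd-print-cf2/`), seat `bsd-line-cf2-p1-w7` g7, planner g20's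
assignment (2026-08-29T11:51:38Z): **GAP-1** of cf2c-w4 g5's `Cruxes/TwoVariableMainConjAtSplitTwoQuad/
ASSEMBLY-GUIDE-measure-side-w4g5.md` §0 — «`IsLTRing (p : 𝒪[F]) q` = `isLTRing_integer F hp` with `hp : p` is a
uniformizer of `F` (true for `F ≅ ℚ₂; to be supplied from «v unramified»)», the base over which the comparison
`ϑ : Ĝ_m → F_f` of de Shalit I §3.2 (3)–(5) (`LubinTate.compSeries` with `f₀ = (1+X)^p − 1`,
`isLTSeries_one_add_X_pow_sub_one (A := 𝒪[F]) p`) is formed.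

RECORD (so that no assembler re-derives it): the tree already holds every ingredient —
`isLTRing_integer F hπ : IsLTRing π (residueFieldCard F)` (`LubinTateField.lean`) for ANY uniformizer `π`,
`Padic.isUniformizer_natCast` (`p` is a uniformizer of `ℚ_p`) and `Padic.residueFieldCard_eq`
(`#𝓀_{ℚ_p} = p`) (`CyclotomicCharacterArtinNormProofs.lean` §4, `LocalFieldPadicProofs.lean`); and the whole
`Ĝ_m`-side over `𝒪_F` with `π = p` — `g = (X+1)^p − 1 ∈ 𝔉_p` (`isLTSeries_X_add_one_pow_sub_one`,
`isLTSeries_cyclotomic`), `[m]_g = (X+1)^m − 1`, the canonical `ϑ = [1]_{g,f}` with `[a]_g ∘ ϑ = ϑ ∘ [a]_f`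
injective on points — is `CyclotomicCharacterArtinNormProofs.lean` §§1–3. This file only packages the base:

* `isLTRing_natCast_of_isUniformizer` — `IsLTRing ((p : ℕ) : 𝒪[F]) p` from «`p` is a uniformizer of `F`» and
  `#𝓀_F = p` (i.e. `F/ℚ_p` unramified of residue degree one); `isLTRing_LTCoeff_natCast_of_isUniformizer` — the
  same on the discrete coefficient copy `LTCoeff F`;
* `Padic.isLTRing_natCast_valuationInteger` — `IsLTRing ((p : ℕ) : 𝒪[ℚ_[p]]) p` (Mathlib's `ℚ_[p]` with the
  tree's local-field structure `Padic.isNonarchimedeanLocalField_holds`), `Padic.isLTRing_LTCoeff_natCast`, and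
  `Padic.isLTSeries_one_add_X_pow_sub_one_valuationInteger` — `(1+X)^p − 1 ∈ 𝔉_p` over `𝒪[ℚ_[p]]`
  (cf2c-w4 g5's `isLTSeries_one_add_X_pow_sub_one`, any commutative ring, read at `A = 𝒪[ℚ_[p]]`).

No definition, no named fact, no `sorry`. HONEST FRAMING: plumbing for brick (d) of the (Q)-socket; BSD is
not advanced by this file.

## References
* [deShalit1987] E. de Shalit, *Iwasawa theory of elliptic curves with complex multiplication* (1987), I §3.2
  (3)–(5) («The special endomorphism of `Ĝ_m` is of course `[p](S) = pS + ⋯`»).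
* [CasselsFrohlichANT1967] J.-P. Serre, *Local class field theory* (Cassels–Fröhlich Ch. VI), §3.3 Example (b),
  §3.5 Prop. 5 Remark 2.
-/

noncomputable section

namespace Literature.NumberTheory.GaloisRepresentations

open ValuativeRel IsNonarchimedeanLocalField LubinTate

section General

variable {F : Type*} [Field F] [ValuativeRel F] [TopologicalSpace F] [IsNonarchimedeanLocalField F]
  {p : ℕ}

/-- **`(𝒪_F, p, p)` is a Lubin–Tate base** when `p` is a uniformizer of `F` and `#𝓀_F = p` (`F/ℚ_p`
unramified of residue degree one, e.g. `F = K_v ≅ ℚ_p` at a split prime): the tree's `isLTRing_integer` with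
`q = #𝓀_F` rewritten to `p`. [cite: CasselsFrohlichANT1967, Ch. VI §3.5 Prop. 5, Remark 2] -/
theorem isLTRing_natCast_of_isUniformizer (hπ : (valuation F).IsUniformizer (((p : ℕ) : 𝒪[F]) : F))
    (hq : residueFieldCard F = p) : IsLTRing ((p : ℕ) : 𝒪[F]) p := by
  have h := isLTRing_integer F hπ
  rwa [hq] at h

/-- The same base on the discrete coefficient copy `LTCoeff F` of `𝒪_F` (the currency of the points files).
[cite: CasselsFrohlichANT1967, Ch. VI §3.5 Prop. 5, Remark 2] -/
theorem isLTRing_LTCoeff_natCast_of_isUniformizer (hπ : (valuation F).IsUniformizer (((p : ℕ) : 𝒪[F]) : F))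
    (hq : residueFieldCard F = p) : IsLTRing (LTCoeff.of F ((p : ℕ) : 𝒪[F])) p := by
  have h := isLTRing_LTCoeff hπ
  rwa [hq] at h

end General

section Padic

open Field

variable (p : ℕ) [Fact p.Prime]

/-- **GAP-1 for `F = ℚ_p`: `(𝒪_{ℚ_p}, p, p)` is a Lubin–Tate base** — `p` is a uniformizer of `ℚ_p`
(`Padic.isUniformizer_natCast`) and `#𝓀_{ℚ_p} = p` (`Padic.residueFieldCard_eq`), for Mathlib's `ℚ_[p]` with
the tree's local-field structure. [cite: CasselsFrohlichANT1967, Ch. VI §3.3 Example (b)] -/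
theorem Padic.isLTRing_natCast_valuationInteger :
    haveI := Padic.isNonarchimedeanLocalField_holds p
    IsLTRing ((p : ℕ) : 𝒪[ℚ_[p]]) p := by
  haveI := Padic.isNonarchimedeanLocalField_holds p
  exact isLTRing_natCast_of_isUniformizer (Padic.isUniformizer_natCast p) (Padic.residueFieldCard_eq p)

/-- The same on the discrete coefficient copy `LTCoeff ℚ_[p]`. [cite: CasselsFrohlichANT1967, Ch. VI §3.3 Example (b)] -/
theorem Padic.isLTRing_LTCoeff_natCast :
    haveI := Padic.isNonarchimedeanLocalField_holds p
    IsLTRing (LTCoeff.of ℚ_[p] ((p : ℕ) : 𝒪[ℚ_[p]])) p := by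
  haveI := Padic.isNonarchimedeanLocalField_holds p
  exact isLTRing_LTCoeff_natCast_of_isUniformizer (Padic.isUniformizer_natCast p) (Padic.residueFieldCard_eq p)

/-- `(1+X)^p − 1 ∈ 𝔉_p` over `𝒪[ℚ_[p]]` — the special endomorphism `[p]` of `Ĝ_m` as a Lubin–Tate series for
the base `Padic.isLTRing_natCast_valuationInteger`. [cite: deShalit1987, I §3.2 (3)–(5)] -/
theorem Padic.isLTSeries_one_add_X_pow_sub_one_valuationInteger :
    haveI := Padic.isNonarchimedeanLocalField_holds p
    IsLTSeries ((p : ℕ) : 𝒪[ℚ_[p]]) p ((1 + PowerSeries.X : PowerSeries 𝒪[ℚ_[p]]) ^ p - 1) :=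
  isLTSeries_one_add_X_pow_sub_one p

end Padic

end Literature.NumberTheory.GaloisRepresentations

end
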